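import Literature.NumberTheory.Automorphic.NewformAdelisation
import HarnessLib

/-!
# Adelisation of classical modular forms: transport of the archimedean calculus of the `GL_n/ℚ`
automorphy datum from `GL_n(mixedSpace ℚ)` to `GL_n(ℝ)`

Topic `NumberTheory/Automorphic`; glue between the Borel–Jacquet formalism of the tree
(`AutomorphicForms`, `AutomorphicRepsGL`: automorphic forms on `GL_n(𝔸_K)` are smooth in the
archimedean variable of the datum `AutomorphyDatum.gl n K hcpt`, whose archimedean group is the full
linear real group `GL_n(mixedSpace K)`, `mixedSpace K = ℝ^{r₁} × ℂ^{r₂}`, with Lie algebra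
`𝔤𝔩_n(mixedSpace K)`, and the `(𝔤, K_∞)`-module structure of an automorphic representation is given
by the Lie derivatives `lieDeriv (AutomorphyDatum.gl n K hcpt).ofArch X`) and the classical
dictionary `f ↔ φ_f` over `ℚ` (`NewformAdelisation*`: functions on `GL_n(ℝ) ⊆ GL_n(𝔸_ℚ)` through
`Rat.ofRealGL : g_∞ ↦ (g_∞, 1)`, `ℝ = ℚ_∞` by `Rat.infiniteAdeleRingEquivReal`). For `K = ℚ` the two
archimedean groups are identified by the structure map `ℝ → mixedSpace ℚ = ℝ^{1} × ℂ^{0}`, and this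
file proves that nothing is lost in translation:

* `Rat.ringEquiv_mixedSpace_infiniteAdeleRingEquivReal_symm` — `ℝ ≅ ℚ_∞ ≅ mixedSpace ℚ` is
  `algebraMap ℝ (mixedSpace ℚ)`; `Rat.ofRealGL_eq_ofInfinite` — `(g, 1) = GLn.ofInfinite (g ⊗ 1)`;
* `Rat.exp_map_algebraMap_mixedSpace`, `Rat.realToMixedGL_expGL`, `Rat.ofRealGL_expGL`,
  `Rat.ofRealGL_mul_expGL_smul` — the matrix exponential, hence the one-parameter subgroups, match:
  `(g exp(tX), 1) = (g, 1) · ι_∞(exp(t (X ⊗ 1)))` (Mathlib `NormedSpace.map_exp` along the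
  continuous ring homomorphism `M ↦ M ⊗ 1`);
* `IsArchSmooth.comp_ofRealGL` — **a function `φ` on `GL_n(𝔸_ℚ)` smooth in the archimedean
  variable of the datum restricts to a function `F_φ = φ ∘ (g ↦ (g, 1))` on `GL_n(ℝ)` smooth in the
  archimedean variable of `RealMatrixGroup.gl ℝ (Fin n)`**;
* `lieDeriv_ofArch_ofRealGL` — **`(X ⊗ 1) φ ((g, 1)) = (X F_φ)(g)`** for `X ∈ 𝔤𝔩_n(ℝ)`: Lie
  derivatives along the datum at points of `GL_n(ℝ) × {1}` are Lie derivatives on `GL_n(ℝ)`.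

So the hypotheses "smooth in the archimedean variable" and "`X · φ = 0`" of the descent
`φ ↦ f_φ` (`NewformAdelisationDescent`, and its holomorphy criterion in terms of the lowering
operator on `GL₂(ℝ)`) are available for the forms of an automorphic representation of `GL₂(𝔸_ℚ)`.
Everything is proved; the only definitions are the abbreviations `Rat.realToMixedGL`,
`Rat.lieOfReal`, `Rat.lieReal`.

## References

* A. Borel, H. Jacquet, *Automorphic forms and automorphic representations*, Proc. Sympos. Pure
  Math. 33 (1979), Part 1, §1.1, §1.5, §4.1 [BorelJacquetCorvallis1979].
* S. Gelbart, *Automorphic forms on adele groups*, Ann. of Math. Stud. 83 (1975), §3.A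
  (`G_∞ ⊆ G_𝔸`) [Gelbart1975].
-/

noncomputable section

open scoped MatrixGroups Matrix ContDiff Topology Classical
open NumberField NumberField.mixedEmbedding IsDedekindDomain

namespace Literature.NumberTheory.Automorphic

-- Mathlib idiom (Mathlib/Algebra/Lie/OfAssociative.lean); needed to mention Lie subalgebras of matrix algebras
attribute [local instance 100] LieRing.ofAssociativeRing

section RealMixed

/-- **`ℝ = ℚ_∞ ≅ mixedSpace ℚ` is the structure map**: composing the identification
`ℝ ≅ 𝔸_{ℚ,∞}` (`Rat.infiniteAdeleRingEquivReal.symm`) with Mathlib's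
`InfiniteAdeleRing.ringEquiv_mixedSpace ℚ : 𝔸_{ℚ,∞} ≃+* mixedSpace ℚ = ℝ^{1} × ℂ^{0}` gives
`algebraMap ℝ (mixedSpace ℚ)`. [folklore] -/
theorem Rat.ringEquiv_mixedSpace_infiniteAdeleRingEquivReal_symm (t : ℝ) :
    InfiniteAdeleRing.ringEquiv_mixedSpace ℚ (Rat.infiniteAdeleRingEquivReal.symm t) =
      algebraMap ℝ (mixedSpace ℚ) t := by
  have h : Rat.infiniteAdeleRingEquivReal.symm t = realToInfiniteAdele ℚ t := by
    apply Rat.infiniteAdeleRingEquivReal.injective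
    rw [RingEquiv.apply_symm_apply, Rat.infiniteAdeleRingEquivReal_realToInfiniteAdele]
  rw [h, realToInfiniteAdele, RingHom.comp_apply, RingEquiv.toRingHom_eq_coe, RingHom.coe_coe,
    RingEquiv.apply_symm_apply]

variable (n : ℕ)

/-- `GL_n(ℝ) →* GL_n(mixedSpace ℚ) = GL_n(ℝ^{1} × ℂ^{0})` induced by the structure map. [folklore] -/
abbrev Rat.realToMixedGL : GL (Fin n) ℝ →* GL (Fin n) (mixedSpace ℚ) :=
  Matrix.GeneralLinearGroup.map (algebraMap ℝ (mixedSpace ℚ))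

/-- **`(g_∞, 1) = GLn.ofInfinite (g_∞)`**: the embedding `Rat.ofRealGL : GL_n(ℝ) → GL_n(𝔸_ℚ)` of
`NewformAdelisation` is the archimedean embedding `GLn.ofInfinite` of the `GL_n` automorphy datum
(`AdelicGLnGlue`) after `GL_n(ℝ) → GL_n(mixedSpace ℚ)`. [folklore] -/
theorem Rat.ofRealGL_eq_ofInfinite (g : GL (Fin n) ℝ) :
    Rat.ofRealGL n g = GLn.ofInfinite n ℚ (Rat.realToMixedGL n g) := by
  rw [Rat.ofRealGL, MonoidHom.comp_apply, GLn.ofArch_eq_ofInfinite]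
  congr 1
  refine Matrix.GeneralLinearGroup.ext fun i j => ?_
  change InfiniteAdeleRing.ringEquiv_mixedSpace ℚ (Rat.infiniteAdeleRingEquivReal.symm (g i j)) = _
  rw [Rat.ringEquiv_mixedSpace_infiniteAdeleRingEquivReal_symm]
  rfl

-- As in `Mathlib/Analysis/Normed/Algebra/MatrixExponential.lean` and `ArchGroupGLCartan`: the scoped
-- `L∞`-operator normed ring structure on matrices is only reducibly-defeq to the Pi topology used by `map`.
set_option backward.isDefEq.respectTransparency false in
open scoped Matrix.Norms.Operator in
/-- The matrix exponential commutes with the structure map `ℝ → mixedSpace ℚ` (`map_exp` along the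
continuous ring homomorphism `M ↦ M.map (algebraMap ℝ _)`). [folklore] -/
theorem Rat.exp_map_algebraMap_mixedSpace (X : Matrix (Fin n) (Fin n) ℝ) :
    NormedSpace.exp (X.map (algebraMap ℝ (mixedSpace ℚ))) =
      (NormedSpace.exp X).map (algebraMap ℝ (mixedSpace ℚ)) :=
  (NormedSpace.map_exp ((algebraMap ℝ (mixedSpace ℚ)).mapMatrix :
      Matrix (Fin n) (Fin n) ℝ →+* Matrix (Fin n) (Fin n) (mixedSpace ℚ))
    (continuous_id.matrix_map (continuous_algebraMap ℝ (mixedSpace ℚ))) X).symm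

/-- `GL_n(ℝ) → GL_n(mixedSpace ℚ)` maps `exp X` to `exp (X ⊗ 1)`. [folklore] -/
theorem Rat.realToMixedGL_expGL (X : Matrix (Fin n) (Fin n) ℝ) :
    Rat.realToMixedGL n (expGL X) = expGL (X.map (algebraMap ℝ (mixedSpace ℚ))) := by
  refine Units.ext ?_
  rw [coe_expGL, Rat.exp_map_algebraMap_mixedSpace]
  rfl

/-- **`(exp X, 1) = ι_∞(exp (X ⊗ 1))`**: the one-parameter subgroups of `GL_n(ℝ) ⊆ GL_n(𝔸_ℚ)`
are the images under `GLn.ofInfinite` of those of the archimedean group `GL_n(mixedSpace ℚ)`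
of the automorphy datum. [folklore] -/
theorem Rat.ofRealGL_expGL (X : Matrix (Fin n) (Fin n) ℝ) :
    Rat.ofRealGL n (expGL X) = GLn.ofInfinite n ℚ (expGL (X.map (algebraMap ℝ (mixedSpace ℚ)))) := by
  rw [Rat.ofRealGL_eq_ofInfinite, Rat.realToMixedGL_expGL]

/-- Scalars pass through `X ↦ X ⊗ 1`: `(t • X).map (algebraMap ℝ _) = t • X.map (algebraMap ℝ _)`.
[folklore] -/
theorem Rat.map_algebraMap_mixedSpace_smul (t : ℝ) (X : Matrix (Fin n) (Fin n) ℝ) :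
    (t • X).map (algebraMap ℝ (mixedSpace ℚ)) = t • X.map (algebraMap ℝ (mixedSpace ℚ)) := by
  refine Matrix.ext fun i j => ?_
  rw [Matrix.map_apply, Matrix.smul_apply, Matrix.smul_apply, Matrix.map_apply, smul_eq_mul, map_mul,
    Algebra.smul_def]

end RealMixed

/-! ### Transport of `IsArchSmooth` and `lieDeriv` -/

section Transport

variable {n : ℕ} {hcpt : isCompact_glFiniteIntegralLevel n ℚ}

/-- A real matrix as an element of the Lie algebra `𝔤𝔩_n(mixedSpace ℚ) = ⊤` of the archimedean group
of the `GL_n/ℚ` automorphy datum, via `X ↦ X ⊗ 1`. [folklore] -/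
abbrev Rat.lieOfReal (hcpt : isCompact_glFiniteIntegralLevel n ℚ) (X : Matrix (Fin n) (Fin n) ℝ) :
    (AutomorphyDatum.gl n ℚ hcpt).arch.lie :=
  ⟨X.map (algebraMap ℝ (mixedSpace ℚ)), LieSubalgebra.mem_top _⟩

/-- A real matrix as an element of the Lie algebra `𝔤𝔩_n(ℝ) = ⊤` of the full linear real group
`RealMatrixGroup.gl ℝ (Fin n)`. [folklore] -/
abbrev Rat.lieReal (X : Matrix (Fin n) (Fin n) ℝ) : (RealMatrixGroup.gl ℝ (Fin n)).lie :=
  ⟨X, LieSubalgebra.mem_top _⟩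

/-- **The one-parameter subgroups match**: `(g exp(tX), 1) = (g, 1) · ι_∞(exp (t (X ⊗ 1)))` in
`GL_n(𝔸_ℚ)`. [folklore] -/
theorem Rat.ofRealGL_mul_expGL_smul (g : GL (Fin n) ℝ) (X : Matrix (Fin n) (Fin n) ℝ) (t : ℝ) :
    Rat.ofRealGL n (g * expGL (t • X)) =
      Rat.ofRealGL n g * GLn.ofInfinite n ℚ (expGL (t • X.map (algebraMap ℝ (mixedSpace ℚ)))) := by
  rw [map_mul, Rat.ofRealGL_expGL, Rat.map_algebraMap_mixedSpace_smul]

/-- The same with the right-hand factor written through the automorphy datum: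
`ι_∞(exp (t (X ⊗ 1))) = ofArch (expMem (t • (X ⊗ 1)))` (definitional). [folklore] -/
theorem Rat.ofArch_expMem_smul_lieOfReal (X : Matrix (Fin n) (Fin n) ℝ) (t : ℝ) :
    (AutomorphyDatum.gl n ℚ hcpt).ofArch ((AutomorphyDatum.gl n ℚ hcpt).arch.expMem (t • Rat.lieOfReal hcpt X)) =
      GLn.ofInfinite n ℚ (expGL (t • X.map (algebraMap ℝ (mixedSpace ℚ)))) :=
  rfl

set_option backward.isDefEq.respectTransparency false in
open scoped Matrix.Norms.Operator in
/-- **Transport of archimedean smoothness.** If `φ : GL_n(𝔸_ℚ) → ℂ` is smooth in the archimedean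
variable of the `GL_n/ℚ` automorphy datum (`IsArchSmooth (AutomorphyDatum.gl n ℚ hcpt).ofArch φ`,
Borel–Jacquet 1979, §4.1: `x_∞ ↦ f(x_∞ x_f)` is `C^∞`), then its restriction
`F_φ = φ ∘ (g_∞ ↦ (g_∞, 1))` to `GL_n(ℝ)` is smooth in the archimedean variable of the full linear
real group `GL_n(ℝ)`: the slice `X ↦ F_φ(g exp X) = φ((g,1) ofArch(exp (X ⊗ 1)))` is the slice of
`φ` at `(g, 1)` composed with the real-linear map `X ↦ X ⊗ 1`.
[cite: BorelJacquetCorvallis1979, §4.1] -/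
theorem IsArchSmooth.comp_ofRealGL {φ : (AdelicGroupData.gl n ℚ).Adelic → ℂ}
    (hφ : IsArchSmooth (AutomorphyDatum.gl n ℚ hcpt).ofArch φ) :
    IsArchSmooth (RealMatrixGroup.gl ℝ (Fin n)).carrier.subtype
      (fun x : GL (Fin n) ℝ => φ (Rat.ofRealGL n x)) := by
  intro g
  -- the real-linear map `X ↦ X ⊗ 1` between the two Lie algebras (both `⊤`)
  let L : (RealMatrixGroup.gl ℝ (Fin n)).lie.toSubmodule →ₗ[ℝ]
      (AutomorphyDatum.gl n ℚ hcpt).arch.lie.toSubmodule :=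
    LinearMap.codRestrict _
      (((Algebra.linearMap ℝ (mixedSpace ℚ)).mapMatrix : Matrix (Fin n) (Fin n) ℝ →ₗ[ℝ]
          Matrix (Fin n) (Fin n) (mixedSpace ℚ)) ∘ₗ (RealMatrixGroup.gl ℝ (Fin n)).lie.toSubmodule.subtype)
      fun _ => LieSubalgebra.mem_top _
  have hL : ContDiff ℝ ∞ (L : (RealMatrixGroup.gl ℝ (Fin n)).lie.toSubmodule →
      (AutomorphyDatum.gl n ℚ hcpt).arch.lie.toSubmodule) :=
    (⟨L, L.continuous_of_finiteDimensional⟩ :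
      (RealMatrixGroup.gl ℝ (Fin n)).lie.toSubmodule →L[ℝ]
        (AutomorphyDatum.gl n ℚ hcpt).arch.lie.toSubmodule).contDiff
  have h := (hφ (Rat.ofRealGL n g)).comp hL
  -- the two slices agree
  have e : (fun X : (RealMatrixGroup.gl ℝ (Fin n)).lie.toSubmodule =>
      (fun x : GL (Fin n) ℝ => φ (Rat.ofRealGL n x))
        (g * (RealMatrixGroup.gl ℝ (Fin n)).carrier.subtype
          ((RealMatrixGroup.gl ℝ (Fin n)).expMem ⟨(X : Matrix (Fin n) (Fin n) ℝ), X.2⟩))) =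
      (fun Y : (AutomorphyDatum.gl n ℚ hcpt).arch.lie.toSubmodule =>
        φ ((show (AdelicGroupData.gl n ℚ).Adelic from Rat.ofRealGL n g) * (AutomorphyDatum.gl n ℚ hcpt).ofArch
          ((AutomorphyDatum.gl n ℚ hcpt).arch.expMem ⟨(Y : Matrix (Fin n) (Fin n) (mixedSpace ℚ)), Y.2⟩))) ∘ L := by
    funext X
    have h1 := Rat.ofRealGL_mul_expGL_smul g (X : Matrix (Fin n) (Fin n) ℝ) 1
    rw [one_smul, one_smul] at h1
    exact congrArg φ h1
  rw [e]
  exact h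

/-- **Transport of Lie derivatives.** For `φ : GL_n(𝔸_ℚ) → ℂ`, `X ∈ 𝔤𝔩_n(ℝ)` and `g ∈ GL_n(ℝ)`:
the Lie derivative of `φ` along `X ⊗ 1 ∈ 𝔤𝔩_n(mixedSpace ℚ)` (the archimedean Lie algebra of the
`GL_n/ℚ` automorphy datum) at `(g, 1)` is the Lie derivative of `F_φ = φ ∘ (g_∞ ↦ (g_∞, 1))` along
`X` at `g` (both are `d/dt φ((g exp(tX), 1))|_{t=0}`). Borel–Jacquet 1979, §1.5 and §4.1.
[cite: BorelJacquetCorvallis1979, §1.5] -/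
theorem lieDeriv_ofArch_ofRealGL (φ : (AdelicGroupData.gl n ℚ).Adelic → ℂ)
    (X : Matrix (Fin n) (Fin n) ℝ) (g : GL (Fin n) ℝ) :
    lieDeriv (AutomorphyDatum.gl n ℚ hcpt).ofArch (Rat.lieOfReal hcpt X) φ (Rat.ofRealGL n g) =
      lieDeriv (RealMatrixGroup.gl ℝ (Fin n)).carrier.subtype (Rat.lieReal X)
        (fun x : GL (Fin n) ℝ => φ (Rat.ofRealGL n x)) g := by
  unfold lieDeriv
  congr 1
  funext t
  exact congrArg φ (Rat.ofRealGL_mul_expGL_smul g X t).symm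

end Transport

end Literature.NumberTheory.Automorphic

end
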